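import Literature.AnabelianGeometry.EtaleTheta.Discharge.Sec5Thm510iii
import Literature.AnabelianGeometry.EtaleTheta.Discharge.Sec5BiThetaIsoCanonical
import Literature.AnabelianGeometry.EtaleTheta.AutOutDictionary
import Literature.AnabelianGeometry.EtaleTheta.Discharge.Sec5Thm510OfRootTransport
import Literature.AnabelianGeometry.EtaleTheta.ThetaRigidity

/-!
# [EtTh] §5: Theorem 5.10 (iii) for the mono-theta environment WITH its `K^×`-Kummer part — the `K^×`-part of `D ⊆ Out(E^Π_N)` is stable under the automorphism `γ` (pp. 331–335 / PDF pp. 105–109)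

Mochizuki, *The étale theta function …*, Publ. RIMS **45** (2009)
[cite: MochizukiEtTh2009, Thm 5.10 (iii) p.334–335 (PDF pp.108–109); Lem 5.9 (iv) p.332 (PDF p.106);
Def 2.13 (i) p.273 (PDF p.47)].  abc-iut cell, layer L2, GAP-LEDGER row G-L2lead-1 (finding F-g4-1 of the
RQ7 audit seat abc-iut-L6-t23, gen 4); PROOF-ONLY (no `def`, no new named fact) over abc-iut-L2-d4's
`Discharge/Sec5Thm510iii.lean`, abc-iut-L2-t11's `Discharge/Sec5BiThetaIsoCanonical.lean` and abc-iut-L2-t4's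
`Discharge/Sec5Thm510OfRootTransport.lean`; no file of theirs is edited, all names are new.

WHY.  Print's `𝕄(𝔉) = (E^Π_N, D, [Im s^⊔-Π_N])` has `D ⊆ Out(E^Π_N)` "generated by the natural outer actions
of `l·ℤ`, `K^×` [cf. Lemma 5.8]" (Lemma 5.9 (iv)), matching the model's `D_Y` = ⟨"the image of `K^×`" (all shifts
by `μ_N`-valued cocycles inflated from `G_K`, abc-iut-L2-t2's `kummerOut`), `Gal(Y/X)`⟩ (Def 2.13 (i)).
abc-iut-L2-t4's `frdMonoThetaEnv … DK` carries the part of the `K^×`-action not given by the unit constants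
`(O_K^×)^{1/N}` as the parameter `DK`; Lemma 5.9 (iv) is certified (abc-iut-L2-t11) at the CANONICAL
`DK₀ := (transport along E^Π_N ⥲ Π^tp_Y[μ_N])⁻¹(kummerOut)`, Theorem 5.10 (iii) so far only at `DK := ∅`
(abc-iut-L2-d4's general theorem has the hypothesis "`γ` stabilises `DK`", vacuous at `∅`).  As
`MonoThetaEnv.Iso.map_D` is an EQUALITY, both halves must hold for the SAME `DK`: here, Thm 5.10 (iii) at `DK₀`.

WHAT IS PROVED.  Generic (`CycEnvelope`): a cocycle shift is `x ↦ δ(x̄)·x`; an automorphism of `Π[μ_N]` of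
that form forces its `c` to be a cocycle; conjugating `α_δ` by an automorphism `γ` mapping `μ_N` to itself by `φ`
and with `γ⁻¹` over `ψinv` on `Π` gives `α_{φ ∘ δ ∘ ψinv}`; inflation from `G_K` is kept when `ψinv` respects
the fibres of `Π ↠ G_K`.  `ThetaEnvData.transport_mem_kummerOut`: transport along such a `γ` maps `kummerOut`
into itself.  `ThetaFrobenioid.transport_envAut_mem_kummerPart`: for every compatible pair `(Φ, ψ)`
(abc-iut-L2-d4's `IsEnvCompatible`; `γ = (Φ, ψ)|_{E^Π_N}`, proof of Thm 5.10 (iii) p.335) with `ψ` preserving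
`Π^tp_Y̲ ∩ Ker(Π^tp_X̲ ↠ G_K)` (`hΔ`), transport along `γ` maps `DK₀` into `DK₀`.  Hence
`exists_monoThetaIso_of_psiAutPreserves_canonical` / `monoThetaEnvCompat_canonical`: **Theorem 5.10 (iii) for
`frdMonoThetaEnv … DK₀`** modulo Theorem 5.10 (ii) as typed, the representative `ψY` and `hΔ`; over
abc-iut-L2-t2's model data `R : RigidData`, `hΔ` IS a clause of the registered fact `R.Cor218_i`
(`aug_iff_of_cor218_i`), whence `monoThetaEnvCompat_canonical_of_cor218_i` and
`Facts.thm510_ii_iii_canonical_of_cor218_i` = abc-iut-L2-t4's `Facts.thm510_ii_iii_of_transports` with `∅`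
replaced by `DK₀`: (ii) ∧ (iii) from Thm 5.7, Thm 4.4 (iv), Cor 2.18 (i) BY NAME and the §5 `Facts`.
HONEST FRAMING: kernel-checked implications between typed statements about the §5 data; [EtTh] is refereed,
nothing of it is asserted unconditionally here; nothing asserts that the data exist for an actual curve;
typed ≠ proved for anything not proved here; no side is taken on any disputed claim downstream
([IUTchIII] Cor. 3.12).
-/

namespace Literature.AnabelianGeometry.EtaleTheta

open CategoryTheory

universe w v v' u u'

/-! ### Generic: conjugating a cocycle shift of a cyclotomic envelope by an automorphism -/

namespace CycEnvelope

variable {P G μ : Type*} [Group P] [Group G] [CommGroup μ] (aug : P →* G) (χ : G →* MulAut μ)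

/-- A cocycle shift is left multiplication by the cyclotome-valued cocycle: `α_δ(y) = δ(ȳ) · y`.
[cite: MochizukiEtTh2009, Prop 2.14 (ii) p.49 (PRIMS p.275)] -/
theorem shift_apply_eq_inMu_mul {δ : P → μ} (hδ : IsEnvCocycle aug χ δ) (y : CycEnvelope aug χ) :
    shift hδ y = inMu aug χ (δ (proj aug χ y)) * y := by
  ext
  · change y.left * δ y.right = δ y.right * (χ.comp aug) 1 y.left
    rw [map_one, MulAut.one_apply, mul_comm]
  · change y.right = 1 * y.right
    rw [one_mul]

/-- Conversely, an automorphism of `Π[μ_N]` of the form `x ↦ c(x̄) · x` for SOME function `c : Π → μ_N`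
forces `c` to be a 1-cocycle.  [cite: MochizukiEtTh2009, Prop 2.14 (ii) p.49 (PRIMS p.275)] -/
theorem isEnvCocycle_of_mulEquiv (F : CycEnvelope aug χ ≃* CycEnvelope aug χ) (c : P → μ)
    (hF : ∀ x, F x = inMu aug χ (c (proj aug χ x)) * x) : IsEnvCocycle aug χ c := by
  intro g h
  have key := map_mul F (algSection aug χ g) (algSection aug χ h)
  rw [hF, hF, hF] at key
  have := congrArg SemidirectProduct.left key
  simpa [SemidirectProduct.mul_left] using this

/-- Conjugating the shift `α_δ` by an automorphism `γ` of `Π[μ_N]` which maps the cyclotome `μ_N` to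
itself (through `φ`) and lies over a permutation of `Π` (its inverse lies over `ψinv`):
`γ ∘ α_δ ∘ γ⁻¹ (x) = φ(δ(ψinv x̄)) · x`.  [cite: MochizukiEtTh2009, Prop 2.14 (ii) p.49 (PRIMS p.275)] -/
theorem congr_shift_apply (γ : CycEnvelope aug χ ≃* CycEnvelope aug χ) {δ : P → μ}
    (hδ : IsEnvCocycle aug χ δ) (φ : μ → μ) (hφ : ∀ a, γ (inMu aug χ a) = inMu aug χ (φ a))
    (ψinv : P → P) (hψ : ∀ x, proj aug χ (γ.symm x) = ψinv (proj aug χ x))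
    (x : CycEnvelope aug χ) :
    MulAut.congr γ (shift hδ) x = inMu aug χ (φ (δ (ψinv (proj aug χ x)))) * x := by
  change γ (shift hδ (γ.symm x)) = _
  rw [shift_apply_eq_inMu_mul, map_mul, hφ, hψ, MulEquiv.apply_symm_apply]

/-- Hence `γ ∘ α_δ ∘ γ⁻¹` is again a cocycle shift, by the cocycle `x̄ ↦ φ(δ(ψinv x̄))`.
[cite: MochizukiEtTh2009, Prop 2.14 (ii) p.49 (PRIMS p.275)] -/
theorem isEnvCocycle_transport (γ : CycEnvelope aug χ ≃* CycEnvelope aug χ) {δ : P → μ}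
    (hδ : IsEnvCocycle aug χ δ) (φ : μ → μ) (hφ : ∀ a, γ (inMu aug χ a) = inMu aug χ (φ a))
    (ψinv : P → P) (hψ : ∀ x, proj aug χ (γ.symm x) = ψinv (proj aug χ x)) :
    IsEnvCocycle aug χ (fun p => φ (δ (ψinv p))) :=
  isEnvCocycle_of_mulEquiv aug χ (MulAut.congr γ (shift hδ)) _
    (congr_shift_apply aug χ γ hδ φ hφ ψinv hψ)

/-- `γ ∘ α_δ ∘ γ⁻¹ = α_{φ ∘ δ ∘ ψinv}`. [cite: MochizukiEtTh2009, Prop 2.14 (ii) p.49 (PRIMS p.275)] -/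
theorem congr_shift_eq_shift (γ : CycEnvelope aug χ ≃* CycEnvelope aug χ) {δ : P → μ}
    (hδ : IsEnvCocycle aug χ δ) (φ : μ → μ) (hφ : ∀ a, γ (inMu aug χ a) = inMu aug χ (φ a))
    (ψinv : P → P) (hψ : ∀ x, proj aug χ (γ.symm x) = ψinv (proj aug χ x)) :
    MulAut.congr γ (shift hδ) = shift (isEnvCocycle_transport aug χ γ hδ φ hφ ψinv hψ) :=
  MulEquiv.ext fun x => by
    rw [congr_shift_apply aug χ γ hδ φ hφ ψinv hψ, shift_apply_eq_inMu_mul]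

/-- A function of `aug(ψinv p)` is a function of `aug p` as soon as `ψinv` respects the fibres of
`aug` (i.e. preserves `Ker aug`): inflation from `G_K` is preserved.  [folklore] -/
private theorem exists_inflate (ψinv : P → P) (haug : ∀ p q, aug p = aug q → aug (ψinv p) = aug (ψinv q))
    (f : G → μ) : ∃ f' : G → μ, ∀ p, f' (aug p) = f (aug (ψinv p)) := by
  classical
  refine ⟨fun g => if h : ∃ p, aug p = g then f (aug (ψinv h.choose)) else 1, fun p => ?_⟩
  have h : ∃ p', aug p' = aug p := ⟨p, rfl⟩
  show (if h : ∃ p', aug p' = aug p then f (aug (ψinv h.choose)) else 1) = f (aug (ψinv p))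
  rw [dif_pos h]
  exact congrArg f (haug _ _ h.choose_spec)

end CycEnvelope

/-! ### The `K^×`-part `kummerOut ⊆ Out(Π^tp_Y[μ_N])` is stable under transport along suitable automorphisms -/

namespace ThetaEnvData

variable {N : ℕ+} (T : ThetaEnvData.{u} N)

/-- **Stability of the Kummer part of `D_Y`** (Def 2.13 (i): "the image of `K^×`", i.e. ALL shifts by
`μ_N`-valued cocycles inflated from `G_K`): transport along an automorphism `γ` of the topological group
`Π^tp_Y[μ_N]` which maps `μ_N` to itself and whose inverse lies over a self-map `ψinv` of `Π^tp_Y`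
respecting the fibres of `Π^tp_Y ↠ G_K` carries `kummerOut` into `kummerOut`.
[cite: MochizukiEtTh2009, Def 2.13 (i) p.47 (PRIMS p.273)] -/
theorem transport_mem_kummerOut (γ : T.env ≃ₜ* T.env) (φ : T.mu → T.mu)
    (hφ : ∀ a, γ (CycEnvelope.inMu T.augY T.chi a) = CycEnvelope.inMu T.augY T.chi (φ a))
    (ψinv : T.PiY → T.PiY)
    (hψ : ∀ x, CycEnvelope.proj T.augY T.chi (γ.symm x) = ψinv (CycEnvelope.proj T.augY T.chi x))
    (haug : ∀ p q : T.PiY, T.augY p = T.augY q → T.augY (ψinv p) = T.augY (ψinv q))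
    {x : TopOut T.env} (hx : x ∈ T.kummerOut) : TopOut.transport γ x ∈ T.kummerOut := by
  obtain ⟨δ, hδ, hc, rfl⟩ := hx
  obtain ⟨δ', hδ'⟩ := CycEnvelope.exists_inflate T.augY ψinv haug (fun g => φ (δ g))
  have hcoc : CycEnvelope.IsEnvCocycle T.augY T.chi (δ' ∘ T.augY) := fun g h' => by
    simpa only [Function.comp_apply, hδ'] using
      CycEnvelope.isEnvCocycle_transport T.augY T.chi γ.toMulEquiv hδ φ hφ ψinv hψ g h'
  have heq : MulAut.congr γ.toMulEquiv (CycEnvelope.shift hδ) = CycEnvelope.shift hcoc := by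
    rw [CycEnvelope.congr_shift_eq_shift T.augY T.chi γ.toMulEquiv hδ φ hφ ψinv hψ]
    congr 1
    funext p
    exact (hδ' p).symm
  have hc' : CycEnvelope.shift hcoc ∈ contMulAut T.env := heq ▸ conjAut_mem_contMulAut γ hc
  refine ⟨δ', hcoc, hc', ?_⟩
  rw [TopOut.transport_mk]
  congr 1
  exact Subtype.ext heq

end ThetaEnvData

/-! ### The §5 application: `γ = (Φ, ψ)|_{E^Π_N}` stabilises the canonical Kummer part `DK₀` -/

namespace ThetaFrobenioid

variable {C : Type u} [Category.{v} C] {D : Type u'} [Category.{v'} D] (𝔉 : ThetaFrobenioid.{w} C D)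

section Canonical

variable (H : 𝔉.Facts) (h1 : 𝔉.SectionsFactor) (h3 : 𝔉.OuterActionLZ) (hsec : 𝔉.SgpCapSection)
  (hcs : 𝔉.SgpCupSection) (h8 : 𝔉.ConstantsEqNormalizer)
  (T : ThetaEnvData.{v} 𝔉.N) (ι : 𝔉.PiX ≃ₜ* T.PiX) (m : 𝔉.muTorsion 𝔉.BN 𝔉.N ≃* T.mu)
  (hY : 𝔉.IdentifiesPiY T ι.toMulEquiv) (hχ : 𝔉.CyclotomicCharacterCompat T ι.toMulEquiv m)

/-- If `ψ` preserves `Π^tp_Y̲ ∩ Ker(Π^tp_X̲ ↠ G_K)` (read through `ι`), so does `ψ⁻¹`. [folklore] -/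
private theorem aug_symm_iff {ψ : 𝔉.PiX ≃ₜ* 𝔉.PiX} (hψY : 𝔉.PiY.map ψ.toMulEquiv.toMonoidHom = 𝔉.PiY)
    (hΔ : ∀ y ∈ 𝔉.PiY, T.aug (ι (ψ y)) = 1 ↔ T.aug (ι y) = 1) :
    ∀ y ∈ 𝔉.PiY, T.aug (ι (ψ.symm y)) = 1 ↔ T.aug (ι y) = 1 := by
  intro y hy
  have hy' : ψ.symm y ∈ 𝔉.PiY := by
    rw [← mem_iff_of_map_equiv_eq (Φ := ψ.toMulEquiv) hψY]
    change ψ (ψ.symm y) ∈ 𝔉.PiY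
    rwa [ψ.apply_symm_apply]
  have := hΔ (ψ.symm y) hy'
  rw [ψ.apply_symm_apply] at this
  exact this.symm

/-- **The automorphism `γ = (Φ, ψ)|_{E^Π_N}` of Thm 5.10 (iii) stabilises the canonical `K^×`-Kummer part
`DK₀ := (transport along E^Π_N ⥲ Π^tp_Y[μ_N])⁻¹(kummerOut)`** of `D` ("generated by the natural outer actions of
`l·ℤ`, `K^×`", Lemma 5.9 (iv) p.332), for every compatible pair `(Φ, ψ)` such that `ψ` preserves
`Π^tp_Y̲ ∩ Ker(Π^tp_X̲ ↠ G_K)` (hypothesis `hΔ`, a clause of [EtTh] Cor 2.18 (i)): `γ` acts on `μ_N(B_N)` by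
`Φ` and lies over `ψ`, so it conjugates the shift by `δ ∘ (Π^tp_Y ↠ G_K)` to the shift by
`Φ ∘ δ ∘ ψ̄⁻¹ ∘ (Π^tp_Y ↠ G_K)`.  [cite: MochizukiEtTh2009, Thm 5.10 (iii) p.335 (PDF p.109)] -/
theorem transport_envAut_mem_kummerPart {Φ : Aut 𝔉.BN ≃* Aut 𝔉.BN} {ψ : 𝔉.PiX ≃ₜ* 𝔉.PiX}
    (hc : 𝔉.IsEnvCompatible Φ ψ) (hΔ : ∀ y ∈ 𝔉.PiY, T.aug (ι (ψ y)) = 1 ↔ T.aug (ι y) = 1)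
    {d : TopOut 𝔉.EPiN}
    (hd : d ∈ TopOut.transport (𝔉.envContIso H T ι m hY hχ) ⁻¹' T.kummerOut) :
    TopOut.transport (𝔉.envAut (hc.stabilizesEPiN hsec)) d ∈
      TopOut.transport (𝔉.envContIso H T ι m hY hχ) ⁻¹' T.kummerOut := by
  set e := 𝔉.envContIso H T ι m hY hχ with he
  let γ' : T.env ≃ₜ* T.env := e.symm.trans ((𝔉.envAut (hc.stabilizesEPiN hsec)).trans e)
  have hγ' : TopOut.transport e (TopOut.transport (𝔉.envAut (hc.stabilizesEPiN hsec)) d) =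
      TopOut.transport γ' (TopOut.transport e d) := by
    change _ = TopOut.transport (e.symm.trans ((𝔉.envAut (hc.stabilizesEPiN hsec)).trans e))
      (TopOut.transport e d)
    rw [TopOut.transport_trans, TopOut.transport_trans, MonoidHom.comp_apply, MonoidHom.comp_apply,
      ← MonoidHom.comp_apply (TopOut.transport e.symm) (TopOut.transport e) d,
      TopOut.transport_symm_comp, MonoidHom.id_apply]
  rw [Set.mem_preimage, hγ']
  have hψY' : ∀ y, ψ.symm y ∈ 𝔉.PiY ↔ y ∈ 𝔉.PiY := fun y => by
    rw [← mem_iff_of_map_equiv_eq (Φ := ψ.toMulEquiv) hc.map_PiY (ψ.symm y)]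
    change ψ (ψ.symm y) ∈ 𝔉.PiY ↔ _
    rw [ψ.apply_symm_apply]
  have hback : ∀ p : T.PiY, ι.symm (p : T.PiX) ∈ 𝔉.PiY := fun p => (hY _).mpr (by
    change ι (ι.symm (p : T.PiX)) ∈ T.PiY
    rw [ι.apply_symm_apply]
    exact p.2)
  have hmem : ∀ p : T.PiY, ι (ψ.symm (ι.symm (p : T.PiX))) ∈ T.PiY := fun p =>
    (hY _).mp ((hψY' _).mpr (hback p))
  refine T.transport_mem_kummerOut γ'
    (fun a => m ⟨Φ ((m.symm a : 𝔉.muTorsion 𝔉.BN 𝔉.N) : Aut 𝔉.BN),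
      hc.apply_mem_muTorsion (m.symm a).2⟩) (fun a => ?_)
    (fun p => ⟨ι (ψ.symm (ι.symm (p : T.PiX))), hmem p⟩) (fun x => ?_) (fun p q hpq => ?_) hd
  · -- `γ'` on the cyclotome
    have h1 : e.symm (CycEnvelope.inMu T.augY T.chi a) = 𝔉.muIncl (m.symm a) := by
      rw [ContinuousMulEquiv.symm_apply_eq]
      change _ = 𝔉.envIso H T ι.toMulEquiv m hY hχ (𝔉.muIncl (m.symm a))
      rw [𝔉.envIso_muIncl, m.apply_symm_apply]
    change e (𝔉.envAut (hc.stabilizesEPiN hsec) (e.symm (CycEnvelope.inMu T.augY T.chi a))) = _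
    rw [h1, hc.envAut_muIncl hsec]
    change 𝔉.envIso H T ι.toMulEquiv m hY hχ (𝔉.muIncl _) = _
    rw [𝔉.envIso_muIncl]
  · -- `γ'⁻¹` lies over `ι ∘ ψ⁻¹ ∘ ι⁻¹` on `Π^tp_Y`
    apply Subtype.ext
    change ((CycEnvelope.proj T.augY T.chi
      (e ((𝔉.envAut (hc.stabilizesEPiN hsec)).symm (e.symm x))) : T.PiY) : T.PiX) = _
    rw [show e ((𝔉.envAut (hc.stabilizesEPiN hsec)).symm (e.symm x)) =
        𝔉.envContIso H T ι m hY hχ ((𝔉.envAut (hc.stabilizesEPiN hsec)).symm (e.symm x)) from rfl,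
      𝔉.envContIso_proj]
    change ι (((((𝔉.envAut (hc.stabilizesEPiN hsec)).symm (e.symm x)) : 𝔉.EPiN) :
      Aut 𝔉.BN × 𝔉.PiX).2) = ι (ψ.symm (ι.symm (CycEnvelope.proj T.augY T.chi x : T.PiX)))
    congr 1
    change (((𝔉.envMulEquiv (hc.stabilizesEPiN hsec)).symm (e.symm x) : 𝔉.EPiN) :
      Aut 𝔉.BN × 𝔉.PiX).2 = _
    rw [coe_envMulEquiv_symm]
    change ψ.symm (((e.symm x : 𝔉.EPiN) : Aut 𝔉.BN × 𝔉.PiX).2) = _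
    congr 1
    have := 𝔉.envIso_symm_coe H T ι.toMulEquiv m hY hχ x
    exact congrArg Prod.snd this
  · -- `ψ⁻¹` respects the fibres of `Π^tp_Y ↠ G_K`
    have hΔ' := 𝔉.aug_symm_iff T ι hc.map_PiY hΔ
    have hp : ι.symm (p : T.PiX) ∈ 𝔉.PiY := hback p
    have hq : ι.symm (q : T.PiX) ∈ 𝔉.PiY := hback q
    have hz : T.aug (ι (ι.symm (p : T.PiX) * (ι.symm (q : T.PiX))⁻¹)) = 1 := by
      rw [map_mul, map_inv, map_mul, map_inv, ι.apply_symm_apply, ι.apply_symm_apply]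
      change T.augY p * (T.augY q)⁻¹ = 1
      rw [hpq, mul_inv_cancel]
    have hz' := (hΔ' _ (𝔉.PiY.mul_mem hp (𝔉.PiY.inv_mem hq))).mpr hz
    simp only [map_mul, map_inv] at hz'
    rw [mul_inv_eq_one] at hz'
    exact hz'

/-- `a⁻¹ · b · a = 1 ↔ b = 1`. [folklore] -/
private theorem inv_mul_mul_eq_one_iff {G₀ : Type*} [Group G₀] (a b : G₀) :
    a⁻¹ * b * a = 1 ↔ b = 1 := by rw [mul_assoc, inv_mul_eq_one, eq_comm, mul_eq_right]

/-- The hypothesis `hΔ` passes from `ψY` to its `Π^tp_X̲`-conjugates `Inn(x₃⁻¹) ∘ ψY` (the representative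
over which the `γ` of Thm 5.10 (iii) lies).  [cite: MochizukiEtTh2009, Thm 5.10 (iii) p.334 (PDF p.108)] -/
theorem aug_conjTop_iff (ψY : 𝔉.PiX ≃ₜ* 𝔉.PiX) (x₃ : 𝔉.PiX)
    (hΔ : ∀ y ∈ 𝔉.PiY, T.aug (ι (ψY y)) = 1 ↔ T.aug (ι y) = 1) :
    ∀ y ∈ 𝔉.PiY, T.aug (ι ((ψY.trans (𝔉.conjTop x₃⁻¹)) y)) = 1 ↔ T.aug (ι y) = 1 := by
  intro y hy
  rw [ContinuousMulEquiv.trans_apply, conjTop_apply, inv_inv]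
  simp only [map_mul, map_inv]
  rw [inv_mul_mul_eq_one_iff]
  exact hΔ y hy

/-- **[EtTh] Theorem 5.10 (iii) for PRINT'S mono-theta environment `𝕄(𝔉)`** = abc-iut-L2-t4's
`frdMonoThetaEnv … DK₀` at the canonical `K^×`-Kummer part `DK₀` (the object of abc-iut-L2-t11's Lemma 5.9 (iv)
`frdIsMonoThetaEnv_canonical`), modulo Theorem 5.10 (ii) as typed (`PsiAutPreserves`), a representative `ψY` of
the automorphisms of `Π^tp_X̲` induced by `Ψ^bs` (over `Ψ^Aut` through `ρ`, preserving `Π^tp_Y̲`, `Π^tp_Ÿ̲`), and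
`hΔ` (`ψY` preserves `Π^tp_Y̲ ∩ Ker(Π^tp_X̲ ↠ G_K)`): abc-iut-L2-d4's `exists_monoThetaIso_of_isEnvCompatible`
with its two `DK`-stability hypotheses DISCHARGED by `transport_envAut_mem_kummerPart`.  Print: "there exists a
commutative diagram … `γ` is an automorphism of topological groups which determines an automorphism of
mono-theta environments and is compatible with the `Π^tp_X`-conjugacy class of automorphisms of `Π^tp_Y`
induced by `Ψ^bs`" (p.334).  [cite: MochizukiEtTh2009, Thm 5.10 (iii) p.334–335 (PDF pp.108–109)] -/
theorem exists_monoThetaIso_of_psiAutPreserves_canonical (Ψ : C ≌ C)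
    (β : Ψ.functor.obj 𝔉.BN ≅ 𝔉.BN) (ΨbiratAut : 𝔉.biratUnits 𝔉.BN ≃* 𝔉.biratUnits 𝔉.BN)
    (hii : 𝔉.PsiAutPreserves Ψ β ΨbiratAut) (ψY : 𝔉.PiX ≃ₜ* 𝔉.PiX)
    (hbase : ∀ g, 𝔉.autBase 𝔉.BN (𝔉.psiAut Ψ β (𝔉.sgpCap (𝔉.ρ g))) = 𝔉.ρ (ψY g))
    (hψY : 𝔉.PiY.map ψY.toMulEquiv.toMonoidHom = 𝔉.PiY)
    (hψYdd : 𝔉.PiYdd.map ψY.toMulEquiv.toMonoidHom = 𝔉.PiYdd)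
    (hΔ : ∀ y ∈ 𝔉.PiY, T.aug (ι (ψY y)) = 1 ↔ T.aug (ι y) = 1) :
    ∃ (x₃ : 𝔉.PiX)
      (γ : (𝔉.frdMonoThetaEnv h1 h3 hsec hcs h8
          (TopOut.transport (𝔉.envContIso H T ι m hY hχ) ⁻¹' T.kummerOut)).Iso
        (𝔉.frdMonoThetaEnv h1 h3 hsec hcs h8
          (TopOut.transport (𝔉.envContIso H T ι m hY hχ) ⁻¹' T.kummerOut)))
      (k : Aut 𝔉.BN), (∀ x, 𝔉.psiAut Ψ β (𝔉.epsilon x) = k * 𝔉.epsilon (γ.e x) * k⁻¹) ∧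
        ∀ x, 𝔉.toPiY (γ.e x) = (ψY.trans (𝔉.conjTop x₃⁻¹)) (𝔉.toPiY x) := by
  obtain ⟨hU, -, -, -, δ₁, δ₂, δ₃, hδ₁, hδ₂, hδ₃, hE, -, hcup⟩ := hii
  obtain ⟨x₃, hx₃⟩ := 𝔉.ρ_surjective (𝔉.autBase 𝔉.BN δ₃)
  have hc := isEnvCompatible_of_thm510ii h3 h8 (𝔉.psiAutEquiv Ψ β) hδ₁ (Subgroup.mem_inf.mp hδ₂).2
    hδ₃ (by rwa [psiAutEquiv_toMonoidHom]) (by rwa [psiAutEquiv_toMonoidHom])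
    (by rwa [psiAutEquiv_toMonoidHom]) ψY (fun g => hbase g) hψY hψYdd x₃ hx₃
  have hΔ₁ := 𝔉.aug_conjTop_iff T ι ψY x₃ hΔ
  have hΔ₂ := 𝔉.aug_symm_iff T ι hc.map_PiY hΔ₁
  refine ⟨x₃, exists_monoThetaIso_of_isEnvCompatible h1 h3 hsec hcs h8 _ Ψ β (δ₁ * δ₂ * δ₃) hc
    (fun a => by rw [MulEquiv.trans_apply, MulAut.conj_apply, inv_inv, psiAutEquiv_apply])
    (fun d hd => Subgroup.subset_closure (Or.inr
      (𝔉.transport_envAut_mem_kummerPart H hsec T ι m hY hχ hc hΔ₁ hd)))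
    (fun d hd => Subgroup.subset_closure (Or.inr
      (𝔉.transport_envAut_mem_kummerPart H hsec T ι m hY hχ (hc.symm hsec) hΔ₂ hd)))⟩

/-- **[EtTh] Theorem 5.10 (iii) as typed (`MonoThetaEnvCompat`, v2) for print's `𝕄(𝔉)`** — the canonical
Kummer part `DK₀` in place of the truncated `DK = ∅` of `Discharge/Sec5Thm510.lean`: rewrap of
`exists_monoThetaIso_of_psiAutPreserves_canonical`.
[cite: MochizukiEtTh2009, Thm 5.10 (iii) p.334–335 (PDF pp.108–109)] -/
theorem monoThetaEnvCompat_canonical (Ψ : C ≌ C)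
    (β : Ψ.functor.obj 𝔉.BN ≅ 𝔉.BN) (ΨbiratAut : 𝔉.biratUnits 𝔉.BN ≃* 𝔉.biratUnits 𝔉.BN)
    (hii : 𝔉.PsiAutPreserves Ψ β ΨbiratAut) (ψY : 𝔉.PiX ≃ₜ* 𝔉.PiX)
    (hbase : ∀ g, 𝔉.autBase 𝔉.BN (𝔉.psiAut Ψ β (𝔉.sgpCap (𝔉.ρ g))) = 𝔉.ρ (ψY g))
    (hψY : 𝔉.PiY.map ψY.toMulEquiv.toMonoidHom = 𝔉.PiY)
    (hψYdd : 𝔉.PiYdd.map ψY.toMulEquiv.toMonoidHom = 𝔉.PiYdd)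
    (hΔ : ∀ y ∈ 𝔉.PiY, T.aug (ι (ψY y)) = 1 ↔ T.aug (ι y) = 1) :
    𝔉.MonoThetaEnvCompat h1 h3 hsec hcs h8
      (TopOut.transport (𝔉.envContIso H T ι m hY hχ) ⁻¹' T.kummerOut) Ψ β ψY hbase hψY hψYdd := by
  obtain ⟨x₃, γ, k, hk, hγ⟩ := 𝔉.exists_monoThetaIso_of_psiAutPreserves_canonical H h1 h3 hsec hcs h8 T ι
    m hY hχ Ψ β ΨbiratAut hii ψY hbase hψY hψYdd hΔ
  exact ⟨x₃, γ, k, hk, fun x => by rw [hγ x, ContinuousMulEquiv.trans_apply, conjTop_apply, inv_inv]⟩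

end Canonical

/-! ### The clause `hΔ` from [EtTh] Cor 2.18 (i) by name (abc-iut-L2-t2's `RigidData.Cor218_i`) -/

section Cor218

variable (H : 𝔉.Facts) (h1 : 𝔉.SectionsFactor) (h3 : 𝔉.OuterActionLZ) (hsec : 𝔉.SgpCapSection)
  (hcs : 𝔉.SgpCupSection) (h8 : 𝔉.ConstantsEqNormalizer) {l : ℕ} (R : RigidData.{v} 𝔉.N l)
  (ι : 𝔉.PiX ≃ₜ* R.PiX) (m : 𝔉.muTorsion 𝔉.BN 𝔉.N ≃* R.mu)
  (hY : 𝔉.IdentifiesPiY R.toThetaEnvData ι.toMulEquiv)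
  (hχ : 𝔉.CyclotomicCharacterCompat R.toThetaEnvData ι.toMulEquiv m)

/-- **`hΔ` is a clause of [EtTh] Cor 2.18 (i)** as typed by abc-iut-L2-t2 (`RigidData.Cor218_i`: every
automorphism of the topological group `Π^tp_X` stabilises, among the theta-related subquotients, `G_K`,
i.e. `Ker(Π^tp_X ↠ G_K)`): applied to the automorphism `ι ∘ ψ ∘ ι⁻¹` it gives `aug(ι(ψ y)) = 1 ↔ aug(ι y) = 1`
for all `y` (in particular on `Π^tp_Y̲`).  [cite: MochizukiEtTh2009, Cor 2.18 (i) p.286 (PDF p.60)] -/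
theorem aug_iff_of_cor218_i (h218 : R.Cor218_i) (ψ : 𝔉.PiX ≃ₜ* 𝔉.PiX) :
    ∀ y ∈ 𝔉.PiY, R.aug (ι (ψ y)) = 1 ↔ R.aug (ι y) = 1 := by
  intro y _
  obtain ⟨-, -, hker, -⟩ := h218 (ι.symm.trans (ψ.trans ι))
  have h := mem_iff_of_map_equiv_eq hker (ι y)
  rw [MonoidHom.mem_ker, MonoidHom.mem_ker] at h
  have e : (ι.symm.trans (ψ.trans ι)).toMulEquiv (ι y) = ι (ψ y) := by
    change ι (ψ (ι.symm (ι y))) = ι (ψ y)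
    rw [ι.symm_apply_apply]
  rw [e] at h
  exact h

/-- **[EtTh] Theorem 5.10 (iii) as typed for print's `𝕄(𝔉)` (`DK := DK₀`) over abc-iut-L2-t2's §2 model data
`R : RigidData`**, modulo Theorem 5.10 (ii) as typed, the representative `ψY`, and [EtTh] Cor 2.18 (i) BY NAME
(`R.Cor218_i`, registered fact) in place of the raw clause `hΔ`.
[cite: MochizukiEtTh2009, Thm 5.10 (iii) p.334–335 (PDF pp.108–109); Cor 2.18 (i) p.286 (PDF p.60)] -/
theorem monoThetaEnvCompat_canonical_of_cor218_i (h218 : R.Cor218_i) (Ψ : C ≌ C)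
    (β : Ψ.functor.obj 𝔉.BN ≅ 𝔉.BN) (ΨbiratAut : 𝔉.biratUnits 𝔉.BN ≃* 𝔉.biratUnits 𝔉.BN)
    (hii : 𝔉.PsiAutPreserves Ψ β ΨbiratAut) (ψY : 𝔉.PiX ≃ₜ* 𝔉.PiX)
    (hbase : ∀ g, 𝔉.autBase 𝔉.BN (𝔉.psiAut Ψ β (𝔉.sgpCap (𝔉.ρ g))) = 𝔉.ρ (ψY g))
    (hψY : 𝔉.PiY.map ψY.toMulEquiv.toMonoidHom = 𝔉.PiY)
    (hψYdd : 𝔉.PiYdd.map ψY.toMulEquiv.toMonoidHom = 𝔉.PiYdd) :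
    𝔉.MonoThetaEnvCompat h1 h3 hsec hcs h8
      (TopOut.transport (𝔉.envContIso H R.toThetaEnvData ι m hY hχ) ⁻¹' R.toThetaEnvData.kummerOut)
      Ψ β ψY hbase hψY hψYdd :=
  𝔉.monoThetaEnvCompat_canonical H h1 h3 hsec hcs h8 R.toThetaEnvData ι m hY hχ Ψ β ΨbiratAut hii ψY
    hbase hψY hψYdd (𝔉.aug_iff_of_cor218_i R ι h218 ψY)

/-- **[EtTh] Theorem 5.10 (ii) ∧ (iii) for print's `𝕄(𝔉)` from Theorem 5.7, Theorem 4.4 (iv) and Cor 2.18 (i)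
BY NAME and the bundled §5 facts** (over `R : RigidData`).
[cite: MochizukiEtTh2009, Thm 5.10 (ii)(iii) p.333–335 (PDF pp.107–109); Cor 2.18 (i) p.286 (PDF p.60)] -/
theorem Facts.thm510_ii_iii_canonical_of_cor218_i (h218 : R.Cor218_i) (Ψ : C ≌ C)
    (β : Ψ.functor.obj 𝔉.BN ≅ 𝔉.BN) (ΨbiratAut : 𝔉.biratUnits 𝔉.BN ≃* 𝔉.biratUnits 𝔉.BN)
    (Ψbs : D ⥤ D) [Ψbs.Faithful] (eΨ : Ψ.functor ⋙ 𝔉.base ≅ 𝔉.base ⋙ Ψbs)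
    (hsq : ∀ u : 𝔉.units 𝔉.BN, ∀ hu : 𝔉.psiAut Ψ β u ∈ 𝔉.units 𝔉.BN,
      ΨbiratAut (𝔉.unitsToBirat 𝔉.BN u) = 𝔉.unitsToBirat 𝔉.BN ⟨_, hu⟩)
    (hconst : 𝔉.constEmb.range.map ΨbiratAut.toMonoidHom = 𝔉.constEmb.range)
    (α : Ψ.functor.obj 𝔉.AN ≅ 𝔉.AN) (e : 𝔉.AN ≅ 𝔉.AN) (Dc Dp : Aut 𝔉.BN)
    (hRT : 𝔉.RootTransportWith Ψ α β e Dc Dp)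
    (θ : Aut (𝔉.base.obj 𝔉.BN) ≃* Aut (𝔉.base.obj 𝔉.BN)) (hST : 𝔉.StrvTransport Ψ α e θ)
    (hθY : 𝔉.imPiY.map θ.toMonoidHom = 𝔉.imPiY) (hθYdd : 𝔉.HB.map θ.toMonoidHom = 𝔉.HB)
    (ψY : 𝔉.PiX ≃ₜ* 𝔉.PiX)
    (hbase : ∀ g, 𝔉.autBase 𝔉.BN (𝔉.psiAut Ψ β (𝔉.sgpCap (𝔉.ρ g))) = 𝔉.ρ (ψY g))
    (hψY : 𝔉.PiY.map ψY.toMulEquiv.toMonoidHom = 𝔉.PiY)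
    (hψYdd : 𝔉.PiYdd.map ψY.toMulEquiv.toMonoidHom = 𝔉.PiYdd) :
    𝔉.PsiAutPreserves Ψ β ΨbiratAut ∧
      𝔉.MonoThetaEnvCompat H.sectionsFactor 𝔉.outerActionLZ_of H.sgpCapSection H.sgpCupSection
        H.constantsEqNormalizer
        (TopOut.transport (𝔉.envContIso H R.toThetaEnvData ι m hY hχ) ⁻¹' R.toThetaEnvData.kummerOut)
        Ψ β ψY hbase hψY hψYdd :=
  have hii : 𝔉.PsiAutPreserves Ψ β ΨbiratAut :=
    H.psiAutPreserves_of_transports Ψ β ΨbiratAut Ψbs eΨ hsq hconst α e Dc Dp hRT θ hST hθY hθYdd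
  ⟨hii, 𝔉.monoThetaEnvCompat_canonical H H.sectionsFactor 𝔉.outerActionLZ_of H.sgpCapSection
    H.sgpCupSection H.constantsEqNormalizer R.toThetaEnvData ι m hY hχ Ψ β ΨbiratAut hii ψY hbase hψY hψYdd
    (𝔉.aug_iff_of_cor218_i R ι h218 ψY)⟩

end Cor218

end ThetaFrobenioid

end Literature.AnabelianGeometry.EtaleTheta
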